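import Literature.MathematicalPhysics.QuantumFieldTheory.Balaban1983to89.BlockAveragingFederbush
import Summits.QuantumFields.YangMills.Theorems.UnitScaleTiltProp7HolRatioPerStep
import Literature.MathematicalPhysics.QuantumFieldTheory.Balaban1983to89.BlockAveragingExpMeanLog
import Literature.MathematicalPhysics.QuantumFieldTheory.Balaban1983to89.B12Average05And08
import Literature.Computability.QuantumAlgorithms.QDriftProductFormula
import HarnessLib

/-!
# Crux stmt-QuantumFields-19936 `HistoryTailL` — S-ALIGN brick T: THE `exp ∕ log` TOOLKIT OF THE SMOOTHING GAUGE
# (first-order products of near-identity factors, the exponential chart, `exp(𝔰𝔲) ⊂ SU`, unitary sandwiches)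

Cell `ym3-torus` (rung R3 = YM₃ on T³ — a RUNG, NOT the Clay problem), width seat `ym-ust-19936-w3` gen 12, `--supports stmt-QuantumFields-19936 --as helper`.
Summons w2 g11 02:42:44Z «w3 g12: S-ALIGN» (the hierarchical chart with geometric decay below the top).  The sharp step conjugates the rooted comb
gauge by `E(x) = exp Φ(x)`, `Φ(x)` a real convex combination of logarithms of coarse holonomies; every link then reads
`exp(A₁)·F·exp(A₂)·exp(A₃)` with `Σ Aᵢ` = the multilinear increment and `F` a unitary within `O(a)` of `1`.  THIS FILE is the matrix analysis, def-free:
§1 `norm_mul_sub_one_sub_add_le` ∕ `prod_step` (first-order additivity of near-identity products, any normed ring); §2 `norm_exp_sub_one_sub_le_sq`,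
`norm_exp_sub_one_le_lin`, `star_exp_of_skew` (the chart); §3 `exp_mem_specialUnitaryGroup` (`exp` of a skew-Hermitian traceless matrix is special
unitary), `star_ite_mlog_eq_neg` ∕ `trace_ite_mlog_eq_zero` (the GUARDED logarithm `if ‖g−1‖<1∕3 then log g else 0` of `g ∈ SU(N)`, `N ≤ 9`, is in `𝔰𝔲`);
`coe_inv_mk_exp`; §4 `norm_sandwich_sub_le`, `norm_coe_sub_coe_eq_dist1`, `norm_mul_coe_sub_le` (unitary bookkeeping; `‖↑g‖ = 1` etc. are ✓`Prop7HolRatioPerStep`, `dist1 = ‖· − 1‖` is ✓`FederbushMean.dist1_SU_eq`).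
-/

noncomputable section

open scoped BigOperators Matrix.Norms.L2Operator
open NormedSpace

namespace Summit.QuantumFields.YangMills.Theorems.PoincareLipschitzHierAlignExpToolkit

open Literature.MathematicalPhysics.QuantumFieldTheory.Balaban1983to89
open Literature.MathematicalPhysics.QuantumFieldTheory.Balaban1983to89.MatrixLog (mlog mlog_one)
open Literature.Analysis.Matrix (det_exp_eq_exp_trace)
open Summit.QuantumFields.YangMills.Theorems.Prop7HolRatioPerStep (coe_star_mul_self coe_mul_star_self norm_coe_eq_one norm_star_coe_eq_one)

/-! ## §1 First-order additivity of near-identity products -/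

section Ring

variable {A : Type*} [NormedRing A]

/-- `PQ − 1 − (a + b) = (P−1)(Q−1) + (P−1−a) + (Q−1−b)`, in norm. [folklore] -/
theorem norm_mul_sub_one_sub_add_le (P Q a b : A) :
    ‖P * Q - 1 - (a + b)‖ ≤ ‖P - 1‖ * ‖Q - 1‖ + ‖P - 1 - a‖ + ‖Q - 1 - b‖ := by
  have e : P * Q - 1 - (a + b) = (P - 1) * (Q - 1) + ((P - 1 - a) + (Q - 1 - b)) := by noncomm_ring
  rw [e]
  refine (norm_add_le _ _).trans ?_
  have h1 := norm_mul_le (P - 1) (Q - 1)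
  have h2 := norm_add_le (P - 1 - a) (Q - 1 - b)
  linarith

/-- `PQ − 1 = (P−1)(Q−1) + (P−1) + (Q−1)`, in norm. [folklore] -/
theorem norm_mul_sub_one_le_of_le {P Q : A} {p q : ℝ} (hP : ‖P - 1‖ ≤ p) (hQ : ‖Q - 1‖ ≤ q) :
    ‖P * Q - 1‖ ≤ p + q + p * q := by
  have e : P * Q - 1 = (P - 1) * (Q - 1) + ((P - 1) + (Q - 1)) := by noncomm_ring
  rw [e]
  refine (norm_add_le _ _).trans ?_
  have hp : 0 ≤ p := (norm_nonneg _).trans hP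
  have h1 : ‖(P - 1) * (Q - 1)‖ ≤ p * q :=
    (norm_mul_le _ _).trans (mul_le_mul hP hQ (norm_nonneg _) hp)
  have h2 := norm_add_le (P - 1) (Q - 1)
  linarith

/-- ★ **THE CHAINING STEP**: sizes `p, q` and first-order defects `α, β` of two factors give size `p + q + pq` and defect `pq + α + β`
of the product (linear part `a + b`). [folklore] -/
theorem prod_step {P Q a b : A} {p q α β : ℝ} (hP : ‖P - 1‖ ≤ p) (hPa : ‖P - 1 - a‖ ≤ α) (hQ : ‖Q - 1‖ ≤ q)
    (hQb : ‖Q - 1 - b‖ ≤ β) :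
    ‖P * Q - 1‖ ≤ p + q + p * q ∧ ‖P * Q - 1 - (a + b)‖ ≤ p * q + α + β := by
  refine ⟨norm_mul_sub_one_le_of_le hP hQ, (norm_mul_sub_one_sub_add_le P Q a b).trans ?_⟩
  have hp : 0 ≤ p := (norm_nonneg _).trans hP
  have h1 : ‖P - 1‖ * ‖Q - 1‖ ≤ p * q := mul_le_mul hP hQ (norm_nonneg _) hp
  linarith

/-- A factor with NO linear part: `‖F − 1 − 0‖ = ‖F − 1‖` (used for the unitary `O(a)` factors). [folklore] -/
theorem norm_sub_one_sub_zero (F : A) : ‖F - 1 - 0‖ = ‖F - 1‖ := by rw [sub_zero]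

/-- A factor that IS its linear part: `‖P − 1 − (P − 1)‖ = 0 ≤ 0`. [folklore] -/
theorem norm_sub_one_sub_self_le (P : A) : ‖P - 1 - (P - 1)‖ ≤ 0 := by rw [sub_self, norm_zero]

end Ring

/-! ## §2 The exponential chart on matrices -/

section Exp

variable {n : Type*} [Fintype n] [DecidableEq n]

/-- For skew-Hermitian `M`, `(exp M)* = exp(−M)`. [folklore] -/
theorem star_exp_of_skew {M : Matrix n n ℂ} (hs : star M = -M) : star (exp M) = exp (-M) := by
  rw [star_exp, hs]

variable [Nonempty n]

/-- `‖exp A − 1 − A‖ ≤ 2x²` for `‖A‖ ≤ x ≤ 1` (`≤ (x²∕2)eˣ`, `e ≤ 3`). [folklore] -/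
theorem norm_exp_sub_one_sub_le_sq {a : Matrix n n ℂ} {x : ℝ} (hax : ‖a‖ ≤ x) (hx : x ≤ 1) : ‖exp a - 1 - a‖ ≤ 2 * x ^ 2 := by
  have h := Literature.Computability.QuantumAlgorithms.QDrift.norm_exp_sub_one_sub_le_of_norm_le ℂ hax
  have he : Real.exp x ≤ 3 := (Real.exp_le_exp.2 hx).trans (by have := Real.exp_one_lt_d9; linarith)
  have hx0 : 0 ≤ x := (norm_nonneg a).trans hax
  have : x ^ 2 / 2 * Real.exp x ≤ x ^ 2 / 2 * 3 := mul_le_mul_of_nonneg_left he (by positivity)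
  have hx2 := sq_nonneg x
  linarith

/-- `‖exp A − 1‖ ≤ x + 2x²` for `‖A‖ ≤ x ≤ 1`. [folklore] -/
theorem norm_exp_sub_one_le_lin {a : Matrix n n ℂ} {x : ℝ} (hax : ‖a‖ ≤ x) (hx : x ≤ 1) : ‖exp a - 1‖ ≤ x + 2 * x ^ 2 := by
  have h := norm_exp_sub_one_sub_le_sq hax hx
  have e : exp a - 1 = (exp a - 1 - a) + a := by abel
  rw [e]
  exact (norm_add_le _ _).trans (by linarith)

end Exp

/-! ## §3 `exp(𝔰𝔲(N)) ⊂ SU(N)` and the guarded logarithm -/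

section SU

variable {n : Type*} [Fintype n] [DecidableEq n]

/-- ★ `exp M ∈ SU(N)` for `M* = −M`, `tr M = 0` (`exp M (exp M)* = exp(M − M) = 1`, `det exp M = e^{tr M} = 1`). [folklore] -/
theorem exp_mem_specialUnitaryGroup {M : Matrix n n ℂ} (hs : star M = -M) (ht : M.trace = 0) :
    exp M ∈ Matrix.specialUnitaryGroup n ℂ := by
  letI : NormedAlgebra ℚ (Matrix n n ℂ) := NormedAlgebra.restrictScalars ℚ ℂ _
  rw [Matrix.mem_specialUnitaryGroup_iff]
  refine ⟨?_, ?_⟩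
  · rw [Matrix.mem_unitaryGroup_iff, star_exp, hs, ← exp_add_of_commute (Commute.refl M).neg_right, add_neg_cancel,
      exp_zero]
  · rw [det_exp_eq_exp_trace, ht, exp_zero]

/-- The inverse of `exp M ∈ SU(N)` (`M ∈ 𝔰𝔲`) is `exp(−M)`, as a matrix. [folklore] -/
theorem coe_inv_mk_exp {M : Matrix n n ℂ} (hs : star M = -M) (ht : M.trace = 0) :
    (((⟨exp M, exp_mem_specialUnitaryGroup hs ht⟩ : Matrix.specialUnitaryGroup n ℂ)⁻¹ : Matrix.specialUnitaryGroup n ℂ) :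
      Matrix n n ℂ) = exp (-M) := by
  change star (exp M) = exp (-M)
  rw [star_exp, hs]

omit [Fintype n] [DecidableEq n] in
/-- Real combinations stay in `𝔰𝔲`: skew part. [folklore] -/
theorem star_sum_smul_eq_neg {ι : Type*} (s : Finset ι) (c : ι → ℝ) (M : ι → Matrix n n ℂ) (hM : ∀ i ∈ s, star (M i) = -M i) :
    star (∑ i ∈ s, (c i : ℂ) • M i) = -∑ i ∈ s, (c i : ℂ) • M i := by
  rw [star_sum, ← Finset.sum_neg_distrib]
  refine Finset.sum_congr rfl fun i hi => ?_
  rw [star_smul, hM i hi, Complex.star_def, Complex.conj_ofReal, smul_neg]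

omit [DecidableEq n] in
/-- Real combinations stay in `𝔰𝔲`: trace part. [folklore] -/
theorem trace_sum_smul_eq_zero {ι : Type*} (s : Finset ι) (c : ι → ℝ) (M : ι → Matrix n n ℂ) (hM : ∀ i ∈ s, (M i).trace = 0) :
    (∑ i ∈ s, (c i : ℂ) • M i).trace = 0 := by
  rw [Matrix.trace_sum]
  exact Finset.sum_eq_zero fun i hi => by rw [Matrix.trace_smul, hM i hi, smul_zero]

/-- The GUARDED logarithm of `g ∈ SU(N)` (`N ≤ 9`) is skew-Hermitian. [folklore] -/
theorem star_ite_mlog_eq_neg (g : Matrix.specialUnitaryGroup n ℂ) :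
    star (if ‖(g : Matrix n n ℂ) - 1‖ < 1 / 3 then mlog (g : Matrix n n ℂ) else 0) =
      -(if ‖(g : Matrix n n ℂ) - 1‖ < 1 / 3 then mlog (g : Matrix n n ℂ) else 0) := by
  split_ifs with h
  · exact ExpMeanLog.star_mlog_eq_neg (Matrix.mem_specialUnitaryGroup_iff.1 g.2).1 h.le
  · simp

/-- The GUARDED logarithm of `g ∈ SU(N)`, `N ≤ 9`, is traceless (`N·(1∕3) < π`). [folklore] -/
theorem trace_ite_mlog_eq_zero (hn : Fintype.card n ≤ 9) (g : Matrix.specialUnitaryGroup n ℂ) :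
    (if ‖(g : Matrix n n ℂ) - 1‖ < 1 / 3 then mlog (g : Matrix n n ℂ) else 0).trace = 0 := by
  split_ifs with h
  · refine ExpMeanLog.trace_mlog_eq_zero g.2 h.le ?_
    have h9 : (Fintype.card n : ℝ) ≤ 9 := by exact_mod_cast hn
    have hπ := Real.pi_gt_three
    calc (Fintype.card n : ℝ) * ‖(g : Matrix n n ℂ) - 1‖ ≤ 9 * (1 / 3) :=
          mul_le_mul h9 h.le (norm_nonneg _) (by norm_num)
      _ < Real.pi := by linarith
  · simp

/-- Under the guard the guarded logarithm IS the logarithm. [folklore] -/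
theorem ite_mlog_eq_of_lt {g : Matrix.specialUnitaryGroup n ℂ} (h : ‖(g : Matrix n n ℂ) - 1‖ < 1 / 3) :
    (if ‖(g : Matrix n n ℂ) - 1‖ < 1 / 3 then mlog (g : Matrix n n ℂ) else 0) = mlog (g : Matrix n n ℂ) := if_pos h

end SU

/-! ## §4 Unitary bookkeeping -/

section Unitary

variable {n : Type*} [Fintype n] [DecidableEq n]

/-- `↑(g h) = ↑g ↑h`. [folklore] -/
theorem coe_mul (g h : Matrix.specialUnitaryGroup n ℂ) :
    ((g * h : Matrix.specialUnitaryGroup n ℂ) : Matrix n n ℂ) = (g : Matrix n n ℂ) * (h : Matrix n n ℂ) := rfl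

/-- **Unitary sandwich**: `‖uXv − uYv‖ ≤ ‖X − Y‖` for `‖u‖, ‖v‖ ≤ 1`. [folklore] -/
theorem norm_sandwich_sub_le {u v X Y : Matrix n n ℂ} (hu : ‖u‖ ≤ 1) (hv : ‖v‖ ≤ 1) :
    ‖u * X * v - u * Y * v‖ ≤ ‖X - Y‖ := by
  have e : u * X * v - u * Y * v = u * (X - Y) * v := by noncomm_ring
  rw [e]
  calc ‖u * (X - Y) * v‖ ≤ ‖u‖ * ‖X - Y‖ * ‖v‖ :=
        (norm_mul_le _ _).trans (mul_le_mul_of_nonneg_right (norm_mul_le _ _) (norm_nonneg _))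
    _ ≤ 1 * ‖X - Y‖ * 1 := by gcongr
    _ = ‖X - Y‖ := by ring

variable [Nonempty n]

/-- `‖↑g − ↑h‖ = dist1 (g h⁻¹)` (right unitary invariance). [folklore] -/
theorem norm_coe_sub_coe_eq_dist1 (g h : Matrix.specialUnitaryGroup n ℂ) :
    ‖(g : Matrix n n ℂ) - (h : Matrix n n ℂ)‖ = dist1 (g * h⁻¹) := by
  rw [FederbushMean.dist1_SU_eq, coe_mul]
  change _ = ‖(g : Matrix n n ℂ) * star (h : Matrix n n ℂ) - 1‖
  apply le_antisymm
  · have e : (g : Matrix n n ℂ) - h = ((g : Matrix n n ℂ) * star (h : Matrix n n ℂ) - 1) * (h : Matrix n n ℂ) := by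
      rw [sub_mul, one_mul, mul_assoc, coe_star_mul_self, mul_one]
    rw [e]
    calc _ ≤ ‖(g : Matrix n n ℂ) * star (h : Matrix n n ℂ) - 1‖ * ‖(h : Matrix n n ℂ)‖ := norm_mul_le _ _
      _ = _ := by rw [norm_coe_eq_one, mul_one]
  · have e : (g : Matrix n n ℂ) * star (h : Matrix n n ℂ) - 1 = ((g : Matrix n n ℂ) - h) * star (h : Matrix n n ℂ) := by
      rw [sub_mul, coe_mul_star_self]
    rw [e]
    calc _ ≤ ‖(g : Matrix n n ℂ) - h‖ * ‖star (h : Matrix n n ℂ)‖ := norm_mul_le _ _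
      _ = _ := by rw [norm_star_coe_eq_one, mul_one]

/-- `‖X ↑g − Y ↑g‖ ≤ ‖X − Y‖` and `‖↑g X − ↑g Y‖ ≤ ‖X − Y‖` (one-sided sandwiches). [folklore] -/
theorem norm_mul_coe_sub_le (X Y : Matrix n n ℂ) (g : Matrix.specialUnitaryGroup n ℂ) :
    ‖X * (g : Matrix n n ℂ) - Y * (g : Matrix n n ℂ)‖ ≤ ‖X - Y‖ ∧ ‖(g : Matrix n n ℂ) * X - (g : Matrix n n ℂ) * Y‖ ≤ ‖X - Y‖ := by
  constructor
  · have h := norm_sandwich_sub_le (u := (1 : Matrix n n ℂ)) (v := (g : Matrix n n ℂ)) (X := X) (Y := Y)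
      (by rw [norm_one]) (norm_coe_eq_one g).le
    simpa only [one_mul] using h
  · have h := norm_sandwich_sub_le (u := (g : Matrix n n ℂ)) (v := (1 : Matrix n n ℂ)) (X := X) (Y := Y)
      (norm_coe_eq_one g).le (by rw [norm_one])
    simpa only [mul_one] using h

end Unitary

end Summit.QuantumFields.YangMills.Theorems.PoincareLipschitzHierAlignExpToolkit

end
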